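/-
Copyright (c) 2026. All rights reserved.
Released under Apache 2.0 license as described in the file LICENSE.
-/
import Literature.NumberTheory.ComplexMultiplication.DegenerateCMTypesElementaryAbelianStabilizerRank
import HarnessLib

/-!
# The MAJORITY TYPE of three odd characters on a finite commutative group of exponent `2`: a CM type of Kubota
# rank `5` in every order `≥ 8`, with survivors `χ₁, χ₂, χ₃, χ₁χ₂χ₃` and stabiliser the joint kernel
# `ker χ₁ ∩ ker χ₂ ∩ ker χ₃` of order `|G|/8`

Setting of the tree's `DegenerateCMTypesElementaryAbelianTwoGroup` (seat p10 g37-#3; T. Kubota [Kubota1965] §4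
Lemma 2 = B. B. Gordon [Gordon1999HodgeAVSurvey] Prop. 9.4.1, `rank(T) = 1 + #{χ odd : Ŝ(χ) ≠ 0}`) on a finite
commutative group `G` of EXPONENT `2` (`G = Gal(K/ℚ)` of a multiquadratic CM field), `T` a CM type w.r.t. `ρ`,
`Ŝ(χ) = Σ_{t∈T} χ(t) = |T| − 2a_χ(T)`, `a_χ(T) = #{t ∈ T : χ(t) = −1}` (B. Dodson's weights [Dodson1984]
§3.1.1).  The tree knows (g38-#8 `exists_survivors_eq_of_typeRank_eq_five`,
`card_le_eight_mul_card_filter_forall_mul_mem_iff_of_typeRank_eq_five`) that a type of rank `5` has exactly the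
survivors `χ₁, χ₂, χ₃, χ₁χ₂χ₃` for three distinct odd characters and a stabiliser of order `≥ |G|/8`, but not that
such types EXIST beyond the orders `8` and `16`.  THIS FILE constructs them in every order: for distinct odd
characters `χ₁, χ₂, χ₃` the MAJORITY TYPE

  `T = Maj(χ₁, χ₂, χ₃) = {g ∈ G : at least two of χ₁(g), χ₂(g), χ₃(g) equal +1}`

(in the Boolean dictionary of C. Carlet [Carlet2020] — types on `⟨ρ⟩ × 𝔽₂ⁿ` as Boolean functions — the pull-back
of the majority function of three variables, Ch. 9 "the majority function … defined as `f(x) = 1` if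
`w_H(x) ≥ n/2`", p. 335; for `|G| = 8` it is the nondegenerate type of the octic group `⟨ρ⟩ × (ℤ/2)²`, and in
general the type INDUCED from that quotient — Kubota's imprimitive types).  Hypothesis form: the theorems take a
finset `T` with `g ∈ T ↔ (χ₁(g) = 1 ∧ χ₂(g) = 1) ∨ (χ₁(g) = 1 ∧ χ₃(g) = 1) ∨ (χ₂(g) = 1 ∧ χ₃(g) = 1)` (`hT`).

* §1 `eight_mul_card_filter_eq_eq_eq` — the SIGNED eight classes: `8·#{g : χ₁(g) = s₁, χ₂(g) = s₂, χ₃(g) = s₃}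
  = |G|` for every sign pattern `(s₁, s₂, s₃) ∈ {±1}³` (expand `Σ_g ∏ (1 + sᵢχᵢ(g))`; the tree's
  `eight_mul_card_filter_eq_one_eq` is `s = (1,1,1)`); `eight_mul_card_filter_eq_eq_eq_of_odd` (hypotheses from
  three DISTINCT ODD characters: in exponent `2` they are automatically independent).
* §2 **`isCMTypeWith_of_majority`** (`Maj` is a CM type: `ρ` reverses all three signs),
  `mul_mem_iff_of_majority` (the joint kernel `N = {χ₁ = χ₂ = χ₃ = 1}` stabilises `Maj`),
  `filter_eq_neg_one_of_majority₁/₂/₃` (`{t ∈ T : χ₁(t) = −1}` is the class `(−,+,+)`, …),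
  `filter_add_eq_one_of_majority` (`{t ∈ T : χ₁χ₂χ₃(t) = 1}` is the class `(+,+,+)`), the sign counts
  `eight_mul_card_filter_of_majority₁/₂/₃` (`8a_{χᵢ}(T) = |G|`), `eight_mul_card_filter_add_of_majority`
  (`8a_{χ₁χ₂χ₃}(T) = 3|G|`), and the sums **`four_mul_sum_char_of_majority₁/₂/₃`** (`4Ŝ(χᵢ) = |G|`),
  **`four_mul_sum_char_add_of_majority`** (`4Ŝ(χ₁χ₂χ₃) = −|G|`).
* §3 **`sum_char_eq_zero_of_majority`** — EVERY OTHER ODD CHARACTER VANISHES on `Maj`: the four survivors already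
  exhaust Parseval's `Σ_{χ odd} Ŝ(χ)² = |T|²` (tree `sum_odd_sq_eq_int`: `4·(|G|/4)² = (|G|/2)²`);
  **`survivors_eq_of_majority`** (`{χ odd : Ŝ(χ) ≠ 0} = {χ₁, χ₂, χ₃, χ₁χ₂χ₃}`),
  **`typeRank_eq_five_of_majority`** (RANK `5` IN EVERY ORDER), **`forall_mul_mem_iff_iff_of_majority`**
  (`Stab(Maj) = N` exactly — joint kernel of the survivors, tree g38-#1) and
  `eight_mul_card_stabilizer_of_majority` (`|Stab(Maj)| = |G|/8`: the EQUALITY case of the tree's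
  `card_le_eight_mul_card_filter_forall_mul_mem_iff_of_typeRank_eq_five` for these types).
* §4 existence: `exists_three_odd` (`|G| ≥ 8`, `ρ ≠ 1` ⟹ three distinct odd characters),
  **`exists_isCMTypeWith_typeRank_eq_five`** (every finite commutative group of exponent `2` and order `≥ 8`
  carries a CM type of Kubota rank `5` w.r.t. any `ρ ≠ 1`).

HONEST SCOPE.  Elementary character sums on Kubota's formula and Parseval; the sources print the formula (Kubota,
Gordon), the weights (Dodson), the majority function and the Walsh calculus (Carlet); the packaging "majority type
of three odd characters" and its rank are this file's regrouping (the type is the lift of the full-rank type of an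
order-`8` quotient; lifts preserve the rank, Shimura §32.9 — not used here).  The pair swaps of `Maj` (ranks
`|G|/4 + 1`, `|G|/4 + 3`) and the existence half of the order-`32` spectrum are the sequel.  THEOREMS ONLY: no
definition, no named fact, no instance, no `sorry`.

## References

* [Kubota1965] T. Kubota, *On the field extension by complex multiplication*, Trans. AMS 118 (1965), §2, §4 Lemma 2.
* [Gordon1999HodgeAVSurvey] B. B. Gordon, *A survey of the Hodge conjecture for abelian varieties*, Prop. 9.4.1.
* [Dodson1984] B. Dodson, *The structure of Galois groups of CM-fields*, Trans. AMS 283 (1984), §3.1.1 Theorem.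
* [Carlet2020] C. Carlet, *Boolean Functions for Cryptography and Coding Theory*, CUP, §2.3 ((2.47) Parseval,
  p. 61), Ch. 9 (majority function, p. 335).

## Provenance

Lane `lit-hodgefound` (Track 2, Layer A3), seat `lit-hodgefound-p10` generation 39, row g39-#2; neighbours cited
by name, nothing restated: `DegenerateCMTypesElementaryAbelianTwoGroup` (`sum_char_eq_card_sub_two_mul`,
`sum_char_eq_zero_iff_two_mul_card_filter_eq`, `sum_odd_sq_eq_int`), `DegenerateCMTypesElementaryAbelianTitsworth`
(`add_self_eq_zero_char`), `DegenerateCMTypesElementaryAbelianStabilizerRank` (`eight_mul_card_filter_eq_one_eq`),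
`DegenerateCMTypesAbelianStabilizerCharacters` (`AbelianStabilizer.survivor_apply_eq_one_of_forall_mul_mem_iff`),
`CMTypeRankCharacters` (`IsCMTypeWith.typeRank_eq_one_add_ncard_oddCharacters`),
`Pohlmann1968/CMTypeRankCharactersNumberField` (`two_mul_ncard_oddCharacters_eq_card`), `CMTypeElementaryTwoGroupOddWeights`
(`character_apply_eq_one_or_of_mul_self`, `sum_character_eq_zero_of_ne_zero`).
-/

open scoped BigOperators Classical

namespace Literature.NumberTheory.ComplexMultiplication

namespace CyclicCMType

namespace ExponentTwo

variable {G : Type*} [CommGroup G] [Fintype G] [DecidableEq G] {ρ : G} {T : Finset G}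
  {χ₁ χ₂ χ₃ : AddChar (Additive G) ℂ}

/-! ## §0 Helpers -/

section Helpers

omit [Fintype G] [DecidableEq G] in
/-- `g·g = 1` in exponent `2`. [folklore] -/
private theorem mul_self_eq_one_mj (hexp : ∀ g : G, g ^ 2 = 1) (g : G) : g * g = 1 := by
  rw [← pow_two]; exact hexp g

omit [Fintype G] [DecidableEq G] in
/-- Characters of a group of exponent `2` are `±1`-valued. [cite: Kubota1965, §4 Lemma 2 (proof)] -/
private theorem char_eq_one_or_mj (hexp : ∀ g : G, g ^ 2 = 1) (χ : AddChar (Additive G) ℂ) (g : G) :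
    χ (Additive.ofMul g) = 1 ∨ χ (Additive.ofMul g) = -1 :=
  character_apply_eq_one_or_of_mul_self χ (mul_self_eq_one_mj hexp g)

omit [Fintype G] [DecidableEq G] in
/-- `χ(gh) = χ(g)χ(h)`. [folklore] -/
private theorem char_mul_mj (χ : AddChar (Additive G) ℂ) (g h : G) :
    χ (Additive.ofMul (g * h)) = χ (Additive.ofMul g) * χ (Additive.ofMul h) := by
  rw [ofMul_mul, AddChar.map_add_eq_mul]

/-- `|G| = 2|T|`. [folklore] -/
private theorem two_mul_card_mj (h : IsCMTypeWith ρ (T : Set G)) : 2 * T.card = Fintype.card G := by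
  have hρ2 : ρ * ρ = 1 := by
    have := h.invol (1 : G)
    simpa [smul_eq_mul] using this
  have hmem : ∀ x : G, ρ * x ∈ T ↔ x ∉ T := fun x => by
    have := h.rho_smul_mem_iff x
    simpa only [smul_eq_mul, Finset.mem_coe] using this
  have hinj : Function.Injective fun s : G => ρ * s := fun a b hab => mul_left_cancel hab
  have hc : Tᶜ = T.image fun s => ρ * s := by
    ext x
    rw [Finset.mem_compl, Finset.mem_image]
    constructor
    · intro hx
      refine ⟨ρ * x, (hmem x).2 hx, ?_⟩
      show ρ * (ρ * x) = x
      rw [← mul_assoc, hρ2, one_mul]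
    · rintro ⟨s, hs, rfl⟩
      exact fun hx => ((hmem s).1 hx) hs
  have h1 : Tᶜ.card = T.card := by rw [hc, Finset.card_image_of_injective _ hinj]
  have h2 := Finset.card_add_card_compl T
  omega

omit [Fintype G] [DecidableEq G] in
/-- An odd character is non-trivial. [folklore] -/
private theorem ne_zero_of_odd {χ : AddChar (Additive G) ℂ} (hχ : χ (Additive.ofMul ρ) = -1) : χ ≠ 0 := by
  intro h0
  rw [h0, AddChar.zero_apply] at hχ
  norm_num at hχ

omit [Fintype G] [DecidableEq G] in
/-- In exponent `2`, distinct characters have non-trivial product: `χ ≠ χ' ⟹ χχ' ≠ 1` (`χ² = 1`).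
[cite: Kubota1965, §4 Lemma 2 (proof)] -/
private theorem add_ne_zero_of_ne (hexp : ∀ g : G, g ^ 2 = 1) {χ χ' : AddChar (Additive G) ℂ} (hne : χ ≠ χ') :
    χ + χ' ≠ 0 := by
  intro h0
  exact hne (add_left_cancel ((add_self_eq_zero_char hexp χ).trans h0.symm))

omit [Fintype G] [DecidableEq G] in
/-- The product of three odd characters is odd. [folklore] -/
private theorem add_add_apply_rho (hχ₁ : χ₁ (Additive.ofMul ρ) = -1) (hχ₂ : χ₂ (Additive.ofMul ρ) = -1)
    (hχ₃ : χ₃ (Additive.ofMul ρ) = -1) : (χ₁ + χ₂ + χ₃) (Additive.ofMul ρ) = -1 := by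
  simp only [AddChar.add_apply, hχ₁, hχ₂, hχ₃]
  norm_num

omit [Fintype G] [DecidableEq G] in
/-- `χ₁ ≠ χ₁χ₂χ₃` for `χ₂ ≠ χ₃` (exponent `2`). [folklore] -/
private theorem ne_add_add₁ (hexp : ∀ g : G, g ^ 2 = 1) (h23 : χ₂ ≠ χ₃) : χ₁ ≠ χ₁ + χ₂ + χ₃ := by
  intro h
  apply add_ne_zero_of_ne hexp h23
  have : χ₁ + 0 = χ₁ + (χ₂ + χ₃) := by rw [add_zero, ← add_assoc]; exact h
  exact (add_left_cancel this).symm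

omit [Fintype G] [DecidableEq G] in
/-- `χ₂ ≠ χ₁χ₂χ₃` for `χ₁ ≠ χ₃` (exponent `2`). [folklore] -/
private theorem ne_add_add₂ (hexp : ∀ g : G, g ^ 2 = 1) (h13 : χ₁ ≠ χ₃) : χ₂ ≠ χ₁ + χ₂ + χ₃ := by
  intro h
  apply add_ne_zero_of_ne hexp h13
  have : χ₂ + 0 = χ₂ + (χ₁ + χ₃) := by
    rw [add_zero]
    calc χ₂ = χ₁ + χ₂ + χ₃ := h
      _ = χ₂ + (χ₁ + χ₃) := by abel
  exact (add_left_cancel this).symm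

omit [Fintype G] [DecidableEq G] in
/-- `χ₃ ≠ χ₁χ₂χ₃` for `χ₁ ≠ χ₂` (exponent `2`). [folklore] -/
private theorem ne_add_add₃ (hexp : ∀ g : G, g ^ 2 = 1) (h12 : χ₁ ≠ χ₂) : χ₃ ≠ χ₁ + χ₂ + χ₃ := by
  intro h
  apply add_ne_zero_of_ne hexp h12
  have : χ₃ + 0 = χ₃ + (χ₁ + χ₂) := by
    rw [add_zero]
    calc χ₃ = χ₁ + χ₂ + χ₃ := h
      _ = χ₃ + (χ₁ + χ₂) := by abel
  exact (add_left_cancel this).symm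

omit [Fintype G] [DecidableEq G] in
/-- The four characters `χ₁, χ₂, χ₃, χ₁χ₂χ₃` are distinct (as a finset of card `4`). [folklore] -/
private theorem card_quad (hexp : ∀ g : G, g ^ 2 = 1) (h12 : χ₁ ≠ χ₂) (h13 : χ₁ ≠ χ₃) (h23 : χ₂ ≠ χ₃) :
    ({χ₁, χ₂, χ₃, χ₁ + χ₂ + χ₃} : Finset (AddChar (Additive G) ℂ)).card = 4 := by
  have hn3 : χ₃ ∉ ({χ₁ + χ₂ + χ₃} : Finset (AddChar (Additive G) ℂ)) := by
    simp only [Finset.mem_singleton]; exact ne_add_add₃ hexp h12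
  have hn2 : χ₂ ∉ ({χ₃, χ₁ + χ₂ + χ₃} : Finset (AddChar (Additive G) ℂ)) := by
    simp only [Finset.mem_insert, Finset.mem_singleton, not_or]; exact ⟨h23, ne_add_add₂ hexp h13⟩
  have hn1 : χ₁ ∉ ({χ₂, χ₃, χ₁ + χ₂ + χ₃} : Finset (AddChar (Additive G) ℂ)) := by
    simp only [Finset.mem_insert, Finset.mem_singleton, not_or]; exact ⟨h12, h13, ne_add_add₁ hexp h23⟩
  rw [Finset.card_insert_of_notMem hn1, Finset.card_insert_of_notMem hn2, Finset.card_insert_of_notMem hn3,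
    Finset.card_singleton]

end Helpers

/-! ## §1 The signed eight classes of three independent characters -/

section Classes

omit [DecidableEq G] in
/-- **Three independent `±1`-characters cut `G` into eight EQUAL sign classes**: for every sign pattern
`(s₁, s₂, s₃) ∈ {±1}³`, `8·#{g : χ₁(g) = s₁, χ₂(g) = s₂, χ₃(g) = s₃} = |G|` (expand
`Σ_g (1 + s₁χ₁(g))(1 + s₂χ₂(g))(1 + s₃χ₃(g))`: every proper product character sums to `0`).  The tree's
`eight_mul_card_filter_eq_one_eq` is the pattern `(+,+,+)`. [cite: Kubota1965, §4 Lemma 2 (proof)]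
[cite: Carlet2020, §2.3 (p. 61)] -/
theorem eight_mul_card_filter_eq_eq_eq (hexp : ∀ g : G, g ^ 2 = 1) (h1 : χ₁ ≠ 0) (h2 : χ₂ ≠ 0) (h3 : χ₃ ≠ 0)
    (h12 : χ₁ + χ₂ ≠ 0) (h13 : χ₁ + χ₃ ≠ 0) (h23 : χ₂ + χ₃ ≠ 0) (h123 : χ₁ + χ₂ + χ₃ ≠ 0) {s₁ s₂ s₃ : ℂ}
    (hs₁ : s₁ = 1 ∨ s₁ = -1) (hs₂ : s₂ = 1 ∨ s₂ = -1) (hs₃ : s₃ = 1 ∨ s₃ = -1) :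
    8 * (Finset.univ.filter fun g : G => χ₁ (Additive.ofMul g) = s₁ ∧ χ₂ (Additive.ofMul g) = s₂ ∧
      χ₃ (Additive.ofMul g) = s₃).card = Fintype.card G := by
  have hkey : ∀ g : G, (1 + s₁ * χ₁ (Additive.ofMul g)) * (1 + s₂ * χ₂ (Additive.ofMul g)) *
      (1 + s₃ * χ₃ (Additive.ofMul g)) =
      if χ₁ (Additive.ofMul g) = s₁ ∧ χ₂ (Additive.ofMul g) = s₂ ∧ χ₃ (Additive.ofMul g) = s₃ then (8 : ℂ)
        else 0 := by
    intro g
    rcases hs₁ with rfl | rfl <;> rcases hs₂ with rfl | rfl <;> rcases hs₃ with rfl | rfl <;>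
      rcases char_eq_one_or_mj hexp χ₁ g with e1 | e1 <;> rcases char_eq_one_or_mj hexp χ₂ g with e2 | e2 <;>
        rcases char_eq_one_or_mj hexp χ₃ g with e3 | e3 <;> simp only [e1, e2, e3] <;> norm_num
  have hsum : ∑ g : G, (1 + s₁ * χ₁ (Additive.ofMul g)) * (1 + s₂ * χ₂ (Additive.ofMul g)) *
      (1 + s₃ * χ₃ (Additive.ofMul g)) =
      8 * ((Finset.univ.filter fun g : G => χ₁ (Additive.ofMul g) = s₁ ∧ χ₂ (Additive.ofMul g) = s₂ ∧
        χ₃ (Additive.ofMul g) = s₃).card : ℂ) := by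
    rw [Finset.sum_congr rfl fun g _ => hkey g, ← Finset.sum_filter, Finset.sum_const, nsmul_eq_mul, mul_comm]
  have hexpand : ∀ g : G,
      (1 + s₁ * χ₁ (Additive.ofMul g)) * (1 + s₂ * χ₂ (Additive.ofMul g)) * (1 + s₃ * χ₃ (Additive.ofMul g)) =
      1 + s₁ * χ₁ (Additive.ofMul g) + s₂ * χ₂ (Additive.ofMul g) + s₃ * χ₃ (Additive.ofMul g) +
        s₁ * s₂ * (χ₁ + χ₂) (Additive.ofMul g) + s₁ * s₃ * (χ₁ + χ₃) (Additive.ofMul g) +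
        s₂ * s₃ * (χ₂ + χ₃) (Additive.ofMul g) + s₁ * s₂ * s₃ * (χ₁ + χ₂ + χ₃) (Additive.ofMul g) := by
    intro g
    simp only [AddChar.add_apply]
    ring
  rw [Finset.sum_congr rfl fun g _ => hexpand g] at hsum
  simp only [Finset.sum_add_distrib, ← Finset.mul_sum, sum_character_eq_zero_of_ne_zero h1,
    sum_character_eq_zero_of_ne_zero h2, sum_character_eq_zero_of_ne_zero h3,
    sum_character_eq_zero_of_ne_zero h12, sum_character_eq_zero_of_ne_zero h13,
    sum_character_eq_zero_of_ne_zero h23, sum_character_eq_zero_of_ne_zero h123, mul_zero, add_zero,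
    Finset.sum_const, Finset.card_univ, nsmul_eq_mul, mul_one] at hsum
  exact_mod_cast hsum.symm

omit [DecidableEq G] in
/-- **The eight sign classes of three DISTINCT ODD characters have `|G|/8` elements each** (in exponent `2`
distinct odd characters are independent: `χᵢχⱼ ≠ 1` for `i ≠ j` and `χ₁χ₂χ₃` is odd, hence `≠ 1`).
[cite: Kubota1965, §4 Lemma 2 (proof)] [cite: Carlet2020, §2.3 (p. 61)] -/
theorem eight_mul_card_filter_eq_eq_eq_of_odd (hexp : ∀ g : G, g ^ 2 = 1) (hχ₁ : χ₁ (Additive.ofMul ρ) = -1)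
    (hχ₂ : χ₂ (Additive.ofMul ρ) = -1) (hχ₃ : χ₃ (Additive.ofMul ρ) = -1) (h12 : χ₁ ≠ χ₂) (h13 : χ₁ ≠ χ₃)
    (h23 : χ₂ ≠ χ₃) {s₁ s₂ s₃ : ℂ} (hs₁ : s₁ = 1 ∨ s₁ = -1) (hs₂ : s₂ = 1 ∨ s₂ = -1)
    (hs₃ : s₃ = 1 ∨ s₃ = -1) :
    8 * (Finset.univ.filter fun g : G => χ₁ (Additive.ofMul g) = s₁ ∧ χ₂ (Additive.ofMul g) = s₂ ∧
      χ₃ (Additive.ofMul g) = s₃).card = Fintype.card G :=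
  eight_mul_card_filter_eq_eq_eq hexp (ne_zero_of_odd hχ₁) (ne_zero_of_odd hχ₂) (ne_zero_of_odd hχ₃)
    (add_ne_zero_of_ne hexp h12) (add_ne_zero_of_ne hexp h13) (add_ne_zero_of_ne hexp h23)
    (ne_zero_of_odd (add_add_apply_rho hχ₁ hχ₂ hχ₃)) hs₁ hs₂ hs₃

end Classes

/-! ## §2 The majority type: CM type, stabilised by the joint kernel, sign counts and character sums -/

section Majority

omit [Fintype G] [DecidableEq G] in
/-- **THE MAJORITY TYPE OF THREE ODD CHARACTERS IS A CM TYPE**: `T = {g : at least two of χ₁(g), χ₂(g), χ₃(g)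
are +1}` contains exactly one of `x, ρx`, since `ρ` reverses all three signs (`χᵢ(ρ) = −1`).
[cite: Kubota1965, §2] [cite: Carlet2020, Ch. 9 (majority function, p. 335)] -/
theorem isCMTypeWith_of_majority (hexp : ∀ g : G, g ^ 2 = 1) (hρ2 : ρ * ρ = 1)
    (hχ₁ : χ₁ (Additive.ofMul ρ) = -1) (hχ₂ : χ₂ (Additive.ofMul ρ) = -1) (hχ₃ : χ₃ (Additive.ofMul ρ) = -1)
    (hT : ∀ g : G, g ∈ T ↔ (χ₁ (Additive.ofMul g) = 1 ∧ χ₂ (Additive.ofMul g) = 1) ∨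
      (χ₁ (Additive.ofMul g) = 1 ∧ χ₃ (Additive.ofMul g) = 1) ∨ (χ₂ (Additive.ofMul g) = 1 ∧ χ₃ (Additive.ofMul g) = 1)) :
    IsCMTypeWith ρ (T : Set G) := by
  refine ⟨fun x => ?_, fun g x => ?_, fun x => ?_⟩
  · simp only [Finset.mem_coe, smul_eq_mul, hT, char_mul_mj, hχ₁, hχ₂, hχ₃]
    rcases char_eq_one_or_mj hexp χ₁ x with e1 | e1 <;> rcases char_eq_one_or_mj hexp χ₂ x with e2 | e2 <;>
      rcases char_eq_one_or_mj hexp χ₃ x with e3 | e3 <;> simp only [e1, e2, e3] <;> norm_num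
  · simp only [smul_eq_mul]
    rw [mul_left_comm]
  · simp only [smul_eq_mul]
    rw [← mul_assoc, hρ2, one_mul]

omit [Fintype G] [DecidableEq G] in
/-- **The joint kernel `N = {χ₁ = χ₂ = χ₃ = 1}` stabilises the majority type**: `tn ∈ T ⟺ t ∈ T` for `n ∈ N`
(`T` is a union of cosets of `N`: the type induced from the quotient `G/N` of order `8`). [cite: Kubota1965, §2] -/
theorem mul_mem_iff_of_majority
    (hT : ∀ g : G, g ∈ T ↔ (χ₁ (Additive.ofMul g) = 1 ∧ χ₂ (Additive.ofMul g) = 1) ∨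
      (χ₁ (Additive.ofMul g) = 1 ∧ χ₃ (Additive.ofMul g) = 1) ∨ (χ₂ (Additive.ofMul g) = 1 ∧ χ₃ (Additive.ofMul g) = 1))
    {n : G} (hn₁ : χ₁ (Additive.ofMul n) = 1) (hn₂ : χ₂ (Additive.ofMul n) = 1) (hn₃ : χ₃ (Additive.ofMul n) = 1)
    (t : G) : t * n ∈ T ↔ t ∈ T := by
  simp only [hT, char_mul_mj, hn₁, hn₂, hn₃, mul_one]

omit [DecidableEq G] in
/-- The `χ₁ = −1` part of the majority type is the sign class `(−,+,+)`. [cite: Dodson1984, §3.1.1 Theorem] -/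
theorem filter_eq_neg_one_of_majority₁ (hexp : ∀ g : G, g ^ 2 = 1)
    (hT : ∀ g : G, g ∈ T ↔ (χ₁ (Additive.ofMul g) = 1 ∧ χ₂ (Additive.ofMul g) = 1) ∨
      (χ₁ (Additive.ofMul g) = 1 ∧ χ₃ (Additive.ofMul g) = 1) ∨ (χ₂ (Additive.ofMul g) = 1 ∧ χ₃ (Additive.ofMul g) = 1)) :
    (T.filter fun s => χ₁ (Additive.ofMul s) = -1) =
      Finset.univ.filter fun g : G => χ₁ (Additive.ofMul g) = -1 ∧ χ₂ (Additive.ofMul g) = 1 ∧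
        χ₃ (Additive.ofMul g) = 1 := by
  ext g
  simp only [Finset.mem_filter, Finset.mem_univ, true_and, hT g]
  rcases char_eq_one_or_mj hexp χ₁ g with e1 | e1 <;> rcases char_eq_one_or_mj hexp χ₂ g with e2 | e2 <;>
    rcases char_eq_one_or_mj hexp χ₃ g with e3 | e3 <;> simp only [e1, e2, e3] <;> norm_num

omit [DecidableEq G] in
/-- The `χ₂ = −1` part of the majority type is the sign class `(+,−,+)`. [cite: Dodson1984, §3.1.1 Theorem] -/
theorem filter_eq_neg_one_of_majority₂ (hexp : ∀ g : G, g ^ 2 = 1)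
    (hT : ∀ g : G, g ∈ T ↔ (χ₁ (Additive.ofMul g) = 1 ∧ χ₂ (Additive.ofMul g) = 1) ∨
      (χ₁ (Additive.ofMul g) = 1 ∧ χ₃ (Additive.ofMul g) = 1) ∨ (χ₂ (Additive.ofMul g) = 1 ∧ χ₃ (Additive.ofMul g) = 1)) :
    (T.filter fun s => χ₂ (Additive.ofMul s) = -1) =
      Finset.univ.filter fun g : G => χ₁ (Additive.ofMul g) = 1 ∧ χ₂ (Additive.ofMul g) = -1 ∧
        χ₃ (Additive.ofMul g) = 1 := by
  ext g
  simp only [Finset.mem_filter, Finset.mem_univ, true_and, hT g]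
  rcases char_eq_one_or_mj hexp χ₁ g with e1 | e1 <;> rcases char_eq_one_or_mj hexp χ₂ g with e2 | e2 <;>
    rcases char_eq_one_or_mj hexp χ₃ g with e3 | e3 <;> simp only [e1, e2, e3] <;> norm_num

omit [DecidableEq G] in
/-- The `χ₃ = −1` part of the majority type is the sign class `(+,+,−)`. [cite: Dodson1984, §3.1.1 Theorem] -/
theorem filter_eq_neg_one_of_majority₃ (hexp : ∀ g : G, g ^ 2 = 1)
    (hT : ∀ g : G, g ∈ T ↔ (χ₁ (Additive.ofMul g) = 1 ∧ χ₂ (Additive.ofMul g) = 1) ∨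
      (χ₁ (Additive.ofMul g) = 1 ∧ χ₃ (Additive.ofMul g) = 1) ∨ (χ₂ (Additive.ofMul g) = 1 ∧ χ₃ (Additive.ofMul g) = 1)) :
    (T.filter fun s => χ₃ (Additive.ofMul s) = -1) =
      Finset.univ.filter fun g : G => χ₁ (Additive.ofMul g) = 1 ∧ χ₂ (Additive.ofMul g) = 1 ∧
        χ₃ (Additive.ofMul g) = -1 := by
  ext g
  simp only [Finset.mem_filter, Finset.mem_univ, true_and, hT g]
  rcases char_eq_one_or_mj hexp χ₁ g with e1 | e1 <;> rcases char_eq_one_or_mj hexp χ₂ g with e2 | e2 <;>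
    rcases char_eq_one_or_mj hexp χ₃ g with e3 | e3 <;> simp only [e1, e2, e3] <;> norm_num

omit [DecidableEq G] in
/-- The `χ₁χ₂χ₃ = +1` part of the majority type is the sign class `(+,+,+)` (on `T` the other even-parity patterns
`(+,−,−), (−,+,−), (−,−,+)` do not occur). [cite: Dodson1984, §3.1.1 Theorem] -/
theorem filter_add_eq_one_of_majority (hexp : ∀ g : G, g ^ 2 = 1)
    (hT : ∀ g : G, g ∈ T ↔ (χ₁ (Additive.ofMul g) = 1 ∧ χ₂ (Additive.ofMul g) = 1) ∨
      (χ₁ (Additive.ofMul g) = 1 ∧ χ₃ (Additive.ofMul g) = 1) ∨ (χ₂ (Additive.ofMul g) = 1 ∧ χ₃ (Additive.ofMul g) = 1)) :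
    (T.filter fun s => (χ₁ + χ₂ + χ₃) (Additive.ofMul s) = 1) =
      Finset.univ.filter fun g : G => χ₁ (Additive.ofMul g) = 1 ∧ χ₂ (Additive.ofMul g) = 1 ∧
        χ₃ (Additive.ofMul g) = 1 := by
  ext g
  simp only [Finset.mem_filter, Finset.mem_univ, true_and, hT g, AddChar.add_apply]
  rcases char_eq_one_or_mj hexp χ₁ g with e1 | e1 <;> rcases char_eq_one_or_mj hexp χ₂ g with e2 | e2 <;>
    rcases char_eq_one_or_mj hexp χ₃ g with e3 | e3 <;> simp only [e1, e2, e3] <;> norm_num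

omit [Fintype G] [DecidableEq G] in
/-- On `T`, `χ₁χ₂χ₃ ≠ 1` means `χ₁χ₂χ₃ = −1` (values `±1`). [folklore] -/
private theorem filter_add_not_eq (hexp : ∀ g : G, g ^ 2 = 1) :
    (T.filter fun s => ¬ (χ₁ + χ₂ + χ₃) (Additive.ofMul s) = 1) =
      T.filter fun s => (χ₁ + χ₂ + χ₃) (Additive.ofMul s) = -1 := by
  refine Finset.filter_congr fun g _ => ?_
  rcases char_eq_one_or_mj hexp (χ₁ + χ₂ + χ₃) g with e | e <;> rw [e] <;> norm_num

omit [DecidableEq G] in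
/-- **`8·a_{χ₁}(Maj) = |G|`.** [cite: Dodson1984, §3.1.1 Theorem] [cite: Kubota1965, §4 Lemma 2] -/
theorem eight_mul_card_filter_of_majority₁ (hexp : ∀ g : G, g ^ 2 = 1) (hχ₁ : χ₁ (Additive.ofMul ρ) = -1)
    (hχ₂ : χ₂ (Additive.ofMul ρ) = -1) (hχ₃ : χ₃ (Additive.ofMul ρ) = -1) (h12 : χ₁ ≠ χ₂) (h13 : χ₁ ≠ χ₃)
    (h23 : χ₂ ≠ χ₃)
    (hT : ∀ g : G, g ∈ T ↔ (χ₁ (Additive.ofMul g) = 1 ∧ χ₂ (Additive.ofMul g) = 1) ∨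
      (χ₁ (Additive.ofMul g) = 1 ∧ χ₃ (Additive.ofMul g) = 1) ∨ (χ₂ (Additive.ofMul g) = 1 ∧ χ₃ (Additive.ofMul g) = 1)) :
    8 * (T.filter fun s => χ₁ (Additive.ofMul s) = -1).card = Fintype.card G := by
  rw [filter_eq_neg_one_of_majority₁ hexp hT]
  exact eight_mul_card_filter_eq_eq_eq_of_odd hexp hχ₁ hχ₂ hχ₃ h12 h13 h23 (Or.inr rfl) (Or.inl rfl) (Or.inl rfl)

omit [DecidableEq G] in
/-- **`8·a_{χ₂}(Maj) = |G|`.** [cite: Dodson1984, §3.1.1 Theorem] [cite: Kubota1965, §4 Lemma 2] -/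
theorem eight_mul_card_filter_of_majority₂ (hexp : ∀ g : G, g ^ 2 = 1) (hχ₁ : χ₁ (Additive.ofMul ρ) = -1)
    (hχ₂ : χ₂ (Additive.ofMul ρ) = -1) (hχ₃ : χ₃ (Additive.ofMul ρ) = -1) (h12 : χ₁ ≠ χ₂) (h13 : χ₁ ≠ χ₃)
    (h23 : χ₂ ≠ χ₃)
    (hT : ∀ g : G, g ∈ T ↔ (χ₁ (Additive.ofMul g) = 1 ∧ χ₂ (Additive.ofMul g) = 1) ∨
      (χ₁ (Additive.ofMul g) = 1 ∧ χ₃ (Additive.ofMul g) = 1) ∨ (χ₂ (Additive.ofMul g) = 1 ∧ χ₃ (Additive.ofMul g) = 1)) :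
    8 * (T.filter fun s => χ₂ (Additive.ofMul s) = -1).card = Fintype.card G := by
  rw [filter_eq_neg_one_of_majority₂ hexp hT]
  exact eight_mul_card_filter_eq_eq_eq_of_odd hexp hχ₁ hχ₂ hχ₃ h12 h13 h23 (Or.inl rfl) (Or.inr rfl) (Or.inl rfl)

omit [DecidableEq G] in
/-- **`8·a_{χ₃}(Maj) = |G|`.** [cite: Dodson1984, §3.1.1 Theorem] [cite: Kubota1965, §4 Lemma 2] -/
theorem eight_mul_card_filter_of_majority₃ (hexp : ∀ g : G, g ^ 2 = 1) (hχ₁ : χ₁ (Additive.ofMul ρ) = -1)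
    (hχ₂ : χ₂ (Additive.ofMul ρ) = -1) (hχ₃ : χ₃ (Additive.ofMul ρ) = -1) (h12 : χ₁ ≠ χ₂) (h13 : χ₁ ≠ χ₃)
    (h23 : χ₂ ≠ χ₃)
    (hT : ∀ g : G, g ∈ T ↔ (χ₁ (Additive.ofMul g) = 1 ∧ χ₂ (Additive.ofMul g) = 1) ∨
      (χ₁ (Additive.ofMul g) = 1 ∧ χ₃ (Additive.ofMul g) = 1) ∨ (χ₂ (Additive.ofMul g) = 1 ∧ χ₃ (Additive.ofMul g) = 1)) :
    8 * (T.filter fun s => χ₃ (Additive.ofMul s) = -1).card = Fintype.card G := by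
  rw [filter_eq_neg_one_of_majority₃ hexp hT]
  exact eight_mul_card_filter_eq_eq_eq_of_odd hexp hχ₁ hχ₂ hχ₃ h12 h13 h23 (Or.inl rfl) (Or.inl rfl) (Or.inr rfl)

/-- **`8·a_{χ₁χ₂χ₃}(Maj) = 3|G|`**: on the majority type the product character is `+1` exactly on the class
`(+,+,+)` (`|G|/8` points) and `−1` on the remaining `3|G|/8` points. [cite: Dodson1984, §3.1.1 Theorem]
[cite: Kubota1965, §4 Lemma 2] -/
theorem eight_mul_card_filter_add_of_majority (hexp : ∀ g : G, g ^ 2 = 1) (hρ2 : ρ * ρ = 1)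
    (hχ₁ : χ₁ (Additive.ofMul ρ) = -1) (hχ₂ : χ₂ (Additive.ofMul ρ) = -1) (hχ₃ : χ₃ (Additive.ofMul ρ) = -1)
    (h12 : χ₁ ≠ χ₂) (h13 : χ₁ ≠ χ₃) (h23 : χ₂ ≠ χ₃)
    (hT : ∀ g : G, g ∈ T ↔ (χ₁ (Additive.ofMul g) = 1 ∧ χ₂ (Additive.ofMul g) = 1) ∨
      (χ₁ (Additive.ofMul g) = 1 ∧ χ₃ (Additive.ofMul g) = 1) ∨ (χ₂ (Additive.ofMul g) = 1 ∧ χ₃ (Additive.ofMul g) = 1)) :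
    8 * (T.filter fun s => (χ₁ + χ₂ + χ₃) (Additive.ofMul s) = -1).card = 3 * Fintype.card G := by
  have hTc := two_mul_card_mj (isCMTypeWith_of_majority hexp hρ2 hχ₁ hχ₂ hχ₃ hT)
  have hsplit := Finset.card_filter_add_card_filter_not (s := T) (fun s => (χ₁ + χ₂ + χ₃) (Additive.ofMul s) = 1)
  rw [filter_add_not_eq hexp, filter_add_eq_one_of_majority hexp hT] at hsplit
  have h8 := eight_mul_card_filter_eq_eq_eq_of_odd hexp hχ₁ hχ₂ hχ₃ h12 h13 h23 (Or.inl rfl) (Or.inl rfl)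
    (Or.inl rfl) (s₁ := (1 : ℂ)) (s₂ := (1 : ℂ)) (s₃ := (1 : ℂ))
  omega

/-- **`4·Ŝ(χ₁) = |G|` on the majority type** (`Ŝ = |T| − 2a`, `|T| = |G|/2`, `a = |G|/8`). [cite: Kubota1965, §4 Lemma 2]
[cite: Dodson1984, §3.1.1 Theorem] -/
theorem four_mul_sum_char_of_majority₁ (hexp : ∀ g : G, g ^ 2 = 1) (hρ2 : ρ * ρ = 1)
    (hχ₁ : χ₁ (Additive.ofMul ρ) = -1) (hχ₂ : χ₂ (Additive.ofMul ρ) = -1) (hχ₃ : χ₃ (Additive.ofMul ρ) = -1)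
    (h12 : χ₁ ≠ χ₂) (h13 : χ₁ ≠ χ₃) (h23 : χ₂ ≠ χ₃)
    (hT : ∀ g : G, g ∈ T ↔ (χ₁ (Additive.ofMul g) = 1 ∧ χ₂ (Additive.ofMul g) = 1) ∨
      (χ₁ (Additive.ofMul g) = 1 ∧ χ₃ (Additive.ofMul g) = 1) ∨ (χ₂ (Additive.ofMul g) = 1 ∧ χ₃ (Additive.ofMul g) = 1)) :
    4 * ∑ s ∈ T, χ₁ (Additive.ofMul s) = Fintype.card G := by
  have hTc := two_mul_card_mj (isCMTypeWith_of_majority hexp hρ2 hχ₁ hχ₂ hχ₃ hT)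
  have ha := eight_mul_card_filter_of_majority₁ hexp hχ₁ hχ₂ hχ₃ h12 h13 h23 hT
  rw [sum_char_eq_card_sub_two_mul hexp χ₁ T]
  have h1 : (Fintype.card G : ℂ) = 2 * (T.card : ℂ) := by exact_mod_cast hTc.symm
  have h2 : (Fintype.card G : ℂ) = 8 * ((T.filter fun s => χ₁ (Additive.ofMul s) = -1).card : ℂ) := by
    exact_mod_cast ha.symm
  linear_combination -2 * h1 + h2

/-- **`4·Ŝ(χ₂) = |G|` on the majority type.** [cite: Kubota1965, §4 Lemma 2] [cite: Dodson1984, §3.1.1 Theorem] -/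
theorem four_mul_sum_char_of_majority₂ (hexp : ∀ g : G, g ^ 2 = 1) (hρ2 : ρ * ρ = 1)
    (hχ₁ : χ₁ (Additive.ofMul ρ) = -1) (hχ₂ : χ₂ (Additive.ofMul ρ) = -1) (hχ₃ : χ₃ (Additive.ofMul ρ) = -1)
    (h12 : χ₁ ≠ χ₂) (h13 : χ₁ ≠ χ₃) (h23 : χ₂ ≠ χ₃)
    (hT : ∀ g : G, g ∈ T ↔ (χ₁ (Additive.ofMul g) = 1 ∧ χ₂ (Additive.ofMul g) = 1) ∨
      (χ₁ (Additive.ofMul g) = 1 ∧ χ₃ (Additive.ofMul g) = 1) ∨ (χ₂ (Additive.ofMul g) = 1 ∧ χ₃ (Additive.ofMul g) = 1)) :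
    4 * ∑ s ∈ T, χ₂ (Additive.ofMul s) = Fintype.card G := by
  have hTc := two_mul_card_mj (isCMTypeWith_of_majority hexp hρ2 hχ₁ hχ₂ hχ₃ hT)
  have ha := eight_mul_card_filter_of_majority₂ hexp hχ₁ hχ₂ hχ₃ h12 h13 h23 hT
  rw [sum_char_eq_card_sub_two_mul hexp χ₂ T]
  have h1 : (Fintype.card G : ℂ) = 2 * (T.card : ℂ) := by exact_mod_cast hTc.symm
  have h2 : (Fintype.card G : ℂ) = 8 * ((T.filter fun s => χ₂ (Additive.ofMul s) = -1).card : ℂ) := by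
    exact_mod_cast ha.symm
  linear_combination -2 * h1 + h2

/-- **`4·Ŝ(χ₃) = |G|` on the majority type.** [cite: Kubota1965, §4 Lemma 2] [cite: Dodson1984, §3.1.1 Theorem] -/
theorem four_mul_sum_char_of_majority₃ (hexp : ∀ g : G, g ^ 2 = 1) (hρ2 : ρ * ρ = 1)
    (hχ₁ : χ₁ (Additive.ofMul ρ) = -1) (hχ₂ : χ₂ (Additive.ofMul ρ) = -1) (hχ₃ : χ₃ (Additive.ofMul ρ) = -1)
    (h12 : χ₁ ≠ χ₂) (h13 : χ₁ ≠ χ₃) (h23 : χ₂ ≠ χ₃)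
    (hT : ∀ g : G, g ∈ T ↔ (χ₁ (Additive.ofMul g) = 1 ∧ χ₂ (Additive.ofMul g) = 1) ∨
      (χ₁ (Additive.ofMul g) = 1 ∧ χ₃ (Additive.ofMul g) = 1) ∨ (χ₂ (Additive.ofMul g) = 1 ∧ χ₃ (Additive.ofMul g) = 1)) :
    4 * ∑ s ∈ T, χ₃ (Additive.ofMul s) = Fintype.card G := by
  have hTc := two_mul_card_mj (isCMTypeWith_of_majority hexp hρ2 hχ₁ hχ₂ hχ₃ hT)
  have ha := eight_mul_card_filter_of_majority₃ hexp hχ₁ hχ₂ hχ₃ h12 h13 h23 hT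
  rw [sum_char_eq_card_sub_two_mul hexp χ₃ T]
  have h1 : (Fintype.card G : ℂ) = 2 * (T.card : ℂ) := by exact_mod_cast hTc.symm
  have h2 : (Fintype.card G : ℂ) = 8 * ((T.filter fun s => χ₃ (Additive.ofMul s) = -1).card : ℂ) := by
    exact_mod_cast ha.symm
  linear_combination -2 * h1 + h2

/-- **`4·Ŝ(χ₁χ₂χ₃) = −|G|` on the majority type** (`a = 3|G|/8`). [cite: Kubota1965, §4 Lemma 2]
[cite: Dodson1984, §3.1.1 Theorem] -/
theorem four_mul_sum_char_add_of_majority (hexp : ∀ g : G, g ^ 2 = 1) (hρ2 : ρ * ρ = 1)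
    (hχ₁ : χ₁ (Additive.ofMul ρ) = -1) (hχ₂ : χ₂ (Additive.ofMul ρ) = -1) (hχ₃ : χ₃ (Additive.ofMul ρ) = -1)
    (h12 : χ₁ ≠ χ₂) (h13 : χ₁ ≠ χ₃) (h23 : χ₂ ≠ χ₃)
    (hT : ∀ g : G, g ∈ T ↔ (χ₁ (Additive.ofMul g) = 1 ∧ χ₂ (Additive.ofMul g) = 1) ∨
      (χ₁ (Additive.ofMul g) = 1 ∧ χ₃ (Additive.ofMul g) = 1) ∨ (χ₂ (Additive.ofMul g) = 1 ∧ χ₃ (Additive.ofMul g) = 1)) :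
    4 * ∑ s ∈ T, (χ₁ + χ₂ + χ₃) (Additive.ofMul s) = -(Fintype.card G : ℂ) := by
  have hTc := two_mul_card_mj (isCMTypeWith_of_majority hexp hρ2 hχ₁ hχ₂ hχ₃ hT)
  have ha := eight_mul_card_filter_add_of_majority hexp hρ2 hχ₁ hχ₂ hχ₃ h12 h13 h23 hT
  rw [sum_char_eq_card_sub_two_mul hexp (χ₁ + χ₂ + χ₃) T]
  have h1 : (Fintype.card G : ℂ) = 2 * (T.card : ℂ) := by exact_mod_cast hTc.symm
  have h2 : (3 * Fintype.card G : ℂ) =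
      8 * ((T.filter fun s => (χ₁ + χ₂ + χ₃) (Additive.ofMul s) = -1).card : ℂ) := by
    exact_mod_cast ha.symm
  linear_combination -2 * h1 + h2

end Majority

/-! ## §3 The survivors are exactly `χ₁, χ₂, χ₃, χ₁χ₂χ₃`: rank `5` and the stabiliser -/

section RankFive

/-- **EVERY OTHER ODD CHARACTER VANISHES ON THE MAJORITY TYPE**: for odd `χ ∉ {χ₁, χ₂, χ₃, χ₁χ₂χ₃}`,
`Ŝ(χ) = Σ_{t∈T} χ(t) = 0` — the four survivors `Ŝ = ±|G|/4` already exhaust Parseval's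
`Σ_{χ odd} Ŝ(χ)² = |T|² = |G|²/4`. [cite: Kubota1965, §4 Lemma 2] [cite: Carlet2020, §2.3 (2.47) (p. 61)] -/
theorem sum_char_eq_zero_of_majority (hexp : ∀ g : G, g ^ 2 = 1) (hρ2 : ρ * ρ = 1)
    (hχ₁ : χ₁ (Additive.ofMul ρ) = -1) (hχ₂ : χ₂ (Additive.ofMul ρ) = -1) (hχ₃ : χ₃ (Additive.ofMul ρ) = -1)
    (h12 : χ₁ ≠ χ₂) (h13 : χ₁ ≠ χ₃) (h23 : χ₂ ≠ χ₃)
    (hT : ∀ g : G, g ∈ T ↔ (χ₁ (Additive.ofMul g) = 1 ∧ χ₂ (Additive.ofMul g) = 1) ∨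
      (χ₁ (Additive.ofMul g) = 1 ∧ χ₃ (Additive.ofMul g) = 1) ∨ (χ₂ (Additive.ofMul g) = 1 ∧ χ₃ (Additive.ofMul g) = 1))
    {χ : AddChar (Additive G) ℂ} (hχ : χ (Additive.ofMul ρ) = -1) (hn1 : χ ≠ χ₁) (hn2 : χ ≠ χ₂) (hn3 : χ ≠ χ₃)
    (hn : χ ≠ χ₁ + χ₂ + χ₃) :
    ∑ s ∈ T, χ (Additive.ofMul s) = 0 := by
  have h := isCMTypeWith_of_majority hexp hρ2 hχ₁ hχ₂ hχ₃ hT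
  have hTc := two_mul_card_mj h
  -- the sign counts: `|G| = 8m`, `|T| = 4m`, `a_{χᵢ} = m`, `a_{χ₁χ₂χ₃} = 3m`
  have hm := eight_mul_card_filter_eq_eq_eq_of_odd hexp hχ₁ hχ₂ hχ₃ h12 h13 h23 (Or.inl rfl) (Or.inl rfl)
    (Or.inl rfl) (s₁ := (1 : ℂ)) (s₂ := (1 : ℂ)) (s₃ := (1 : ℂ))
  set m := (Finset.univ.filter fun g : G => χ₁ (Additive.ofMul g) = 1 ∧ χ₂ (Additive.ofMul g) = 1 ∧
    χ₃ (Additive.ofMul g) = 1).card with hm_def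
  have ha₁ := eight_mul_card_filter_of_majority₁ hexp hχ₁ hχ₂ hχ₃ h12 h13 h23 hT
  have ha₂ := eight_mul_card_filter_of_majority₂ hexp hχ₁ hχ₂ hχ₃ h12 h13 h23 hT
  have ha₃ := eight_mul_card_filter_of_majority₃ hexp hχ₁ hχ₂ hχ₃ h12 h13 h23 hT
  have ha := eight_mul_card_filter_add_of_majority hexp hρ2 hχ₁ hχ₂ hχ₃ h12 h13 h23 hT
  have c0 : (T.card : ℤ) = 4 * m := by exact_mod_cast (show T.card = 4 * m by omega)
  have c1 : ((T.filter fun s => χ₁ (Additive.ofMul s) = -1).card : ℤ) = m := by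
    exact_mod_cast (show (T.filter fun s => χ₁ (Additive.ofMul s) = -1).card = m by omega)
  have c2 : ((T.filter fun s => χ₂ (Additive.ofMul s) = -1).card : ℤ) = m := by
    exact_mod_cast (show (T.filter fun s => χ₂ (Additive.ofMul s) = -1).card = m by omega)
  have c3 : ((T.filter fun s => χ₃ (Additive.ofMul s) = -1).card : ℤ) = m := by
    exact_mod_cast (show (T.filter fun s => χ₃ (Additive.ofMul s) = -1).card = m by omega)
  have c4 : ((T.filter fun s => (χ₁ + χ₂ + χ₃) (Additive.ofMul s) = -1).card : ℤ) = 3 * m := by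
    exact_mod_cast (show (T.filter fun s => (χ₁ + χ₂ + χ₃) (Additive.ofMul s) = -1).card = 3 * m by omega)
  -- Parseval over the odd characters, split along the four known survivors
  set O := Finset.univ.filter (fun ψ : AddChar (Additive G) ℂ => ψ (Additive.ofMul ρ) = -1) with hO
  have hFO : ({χ₁, χ₂, χ₃, χ₁ + χ₂ + χ₃} : Finset (AddChar (Additive G) ℂ)) ⊆ O := by
    intro ψ hψ
    simp only [Finset.mem_insert, Finset.mem_singleton] at hψ
    rw [hO, Finset.mem_filter]
    refine ⟨Finset.mem_univ _, ?_⟩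
    rcases hψ with rfl | rfl | rfl | rfl
    · exact hχ₁
    · exact hχ₂
    · exact hχ₃
    · exact add_add_apply_rho hχ₁ hχ₂ hχ₃
  have hn3' : χ₃ ∉ ({χ₁ + χ₂ + χ₃} : Finset (AddChar (Additive G) ℂ)) := by
    simp only [Finset.mem_singleton]; exact ne_add_add₃ hexp h12
  have hn2' : χ₂ ∉ ({χ₃, χ₁ + χ₂ + χ₃} : Finset (AddChar (Additive G) ℂ)) := by
    simp only [Finset.mem_insert, Finset.mem_singleton, not_or]; exact ⟨h23, ne_add_add₂ hexp h13⟩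
  have hn1' : χ₁ ∉ ({χ₂, χ₃, χ₁ + χ₂ + χ₃} : Finset (AddChar (Additive G) ℂ)) := by
    simp only [Finset.mem_insert, Finset.mem_singleton, not_or]; exact ⟨h12, h13, ne_add_add₁ hexp h23⟩
  have hFsum : ∑ ψ ∈ ({χ₁, χ₂, χ₃, χ₁ + χ₂ + χ₃} : Finset (AddChar (Additive G) ℂ)),
      ((T.card : ℤ) - 2 * ((T.filter fun s => ψ (Additive.ofMul s) = -1).card : ℤ)) ^ 2 = (T.card : ℤ) ^ 2 := by
    rw [Finset.sum_insert hn1', Finset.sum_insert hn2', Finset.sum_insert hn3', Finset.sum_singleton, c0, c1, c2,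
      c3, c4]
    ring
  have hP := sum_odd_sq_eq_int hexp h
  rw [← Finset.sum_sdiff hFO, hFsum] at hP
  have hrest : ∑ ψ ∈ O \ {χ₁, χ₂, χ₃, χ₁ + χ₂ + χ₃},
      ((T.card : ℤ) - 2 * ((T.filter fun s => ψ (Additive.ofMul s) = -1).card : ℤ)) ^ 2 = 0 := by
    linear_combination hP
  have hmem : χ ∈ O \ {χ₁, χ₂, χ₃, χ₁ + χ₂ + χ₃} := by
    rw [Finset.mem_sdiff, hO, Finset.mem_filter]
    simp only [Finset.mem_insert, Finset.mem_singleton, not_or]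
    exact ⟨⟨Finset.mem_univ _, hχ⟩, hn1, hn2, hn3, hn⟩
  have hterm := (Finset.sum_eq_zero_iff_of_nonneg fun ψ _ => sq_nonneg _).1 hrest χ hmem
  have h0 : (T.card : ℤ) = 2 * ((T.filter fun s => χ (Additive.ofMul s) = -1).card : ℤ) :=
    sub_eq_zero.1 ((pow_eq_zero_iff two_ne_zero).1 hterm)
  exact (sum_char_eq_zero_iff_two_mul_card_filter_eq hexp χ T).2 (by exact_mod_cast h0.symm)

/-- **THE SURVIVORS OF THE MAJORITY TYPE ARE EXACTLY `χ₁, χ₂, χ₃, χ₁χ₂χ₃`.** [cite: Kubota1965, §4 Lemma 2]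
[cite: Dodson1984, §3.1.1 Theorem] -/
theorem survivors_eq_of_majority (hexp : ∀ g : G, g ^ 2 = 1) (hρ2 : ρ * ρ = 1)
    (hχ₁ : χ₁ (Additive.ofMul ρ) = -1) (hχ₂ : χ₂ (Additive.ofMul ρ) = -1) (hχ₃ : χ₃ (Additive.ofMul ρ) = -1)
    (h12 : χ₁ ≠ χ₂) (h13 : χ₁ ≠ χ₃) (h23 : χ₂ ≠ χ₃)
    (hT : ∀ g : G, g ∈ T ↔ (χ₁ (Additive.ofMul g) = 1 ∧ χ₂ (Additive.ofMul g) = 1) ∨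
      (χ₁ (Additive.ofMul g) = 1 ∧ χ₃ (Additive.ofMul g) = 1) ∨ (χ₂ (Additive.ofMul g) = 1 ∧ χ₃ (Additive.ofMul g) = 1)) :
    ((Finset.univ.filter fun χ : AddChar (Additive G) ℂ => χ (Additive.ofMul ρ) = -1).filter
      fun χ => ∑ s ∈ T, χ (Additive.ofMul s) ≠ 0) = {χ₁, χ₂, χ₃, χ₁ + χ₂ + χ₃} := by
  have hG : (Fintype.card G : ℂ) ≠ 0 := by exact_mod_cast Fintype.card_ne_zero
  have hS₁ : ∑ s ∈ T, χ₁ (Additive.ofMul s) ≠ 0 := fun h0 => by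
    have := four_mul_sum_char_of_majority₁ hexp hρ2 hχ₁ hχ₂ hχ₃ h12 h13 h23 hT
    rw [h0, mul_zero] at this; exact hG this.symm
  have hS₂ : ∑ s ∈ T, χ₂ (Additive.ofMul s) ≠ 0 := fun h0 => by
    have := four_mul_sum_char_of_majority₂ hexp hρ2 hχ₁ hχ₂ hχ₃ h12 h13 h23 hT
    rw [h0, mul_zero] at this; exact hG this.symm
  have hS₃ : ∑ s ∈ T, χ₃ (Additive.ofMul s) ≠ 0 := fun h0 => by
    have := four_mul_sum_char_of_majority₃ hexp hρ2 hχ₁ hχ₂ hχ₃ h12 h13 h23 hT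
    rw [h0, mul_zero] at this; exact hG this.symm
  have hS₄ : ∑ s ∈ T, (χ₁ + χ₂ + χ₃) (Additive.ofMul s) ≠ 0 := fun h0 => by
    have := four_mul_sum_char_add_of_majority hexp hρ2 hχ₁ hχ₂ hχ₃ h12 h13 h23 hT
    rw [h0, mul_zero] at this; exact hG (neg_eq_zero.1 this.symm)
  ext χ
  simp only [Finset.mem_filter, Finset.mem_univ, true_and, Finset.mem_insert, Finset.mem_singleton]
  constructor
  · rintro ⟨hχ, hS⟩
    by_contra hno
    simp only [not_or] at hno
    exact hS (sum_char_eq_zero_of_majority hexp hρ2 hχ₁ hχ₂ hχ₃ h12 h13 h23 hT hχ hno.1 hno.2.1 hno.2.2.1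
      hno.2.2.2)
  · rintro (rfl | rfl | rfl | rfl)
    · exact ⟨hχ₁, hS₁⟩
    · exact ⟨hχ₂, hS₂⟩
    · exact ⟨hχ₃, hS₃⟩
    · exact ⟨add_add_apply_rho hχ₁ hχ₂ hχ₃, hS₄⟩

/-- **THE MAJORITY TYPE OF THREE DISTINCT ODD CHARACTERS HAS KUBOTA RANK `5`** — on EVERY finite commutative group
of exponent `2` (any order `≥ 8`); on the field side: every multiquadratic CM field of degree `≥ 8` has CM types
of rank `5` (those induced from a nondegenerate type of an octic subfield `K^N`). [cite: Kubota1965, §4 Lemma 2]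
[cite: Gordon1999HodgeAVSurvey, §9.4.1 (Proposition [B.60])] -/
theorem typeRank_eq_five_of_majority (hexp : ∀ g : G, g ^ 2 = 1) (hρ2 : ρ * ρ = 1)
    (hχ₁ : χ₁ (Additive.ofMul ρ) = -1) (hχ₂ : χ₂ (Additive.ofMul ρ) = -1) (hχ₃ : χ₃ (Additive.ofMul ρ) = -1)
    (h12 : χ₁ ≠ χ₂) (h13 : χ₁ ≠ χ₃) (h23 : χ₂ ≠ χ₃)
    (hT : ∀ g : G, g ∈ T ↔ (χ₁ (Additive.ofMul g) = 1 ∧ χ₂ (Additive.ofMul g) = 1) ∨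
      (χ₁ (Additive.ofMul g) = 1 ∧ χ₃ (Additive.ofMul g) = 1) ∨ (χ₂ (Additive.ofMul g) = 1 ∧ χ₃ (Additive.ofMul g) = 1)) :
    typeRank G (T : Set G) = 5 := by
  have h := isCMTypeWith_of_majority hexp hρ2 hχ₁ hχ₂ hχ₃ hT
  rw [h.typeRank_eq_one_add_ncard_oddCharacters]
  have hset : {χ : AddChar (Additive G) ℂ | χ (Additive.ofMul ρ) = -1 ∧ ∑ s ∈ T, χ (Additive.ofMul s) ≠ 0} =
      ↑(((Finset.univ.filter fun χ : AddChar (Additive G) ℂ => χ (Additive.ofMul ρ) = -1).filter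
        fun χ => ∑ s ∈ T, χ (Additive.ofMul s) ≠ 0)) := by
    ext χ
    simp only [Set.mem_setOf_eq, Finset.coe_filter, Finset.mem_filter, Finset.mem_univ, true_and]
  rw [hset, Set.ncard_coe_finset, survivors_eq_of_majority hexp hρ2 hχ₁ hχ₂ hχ₃ h12 h13 h23 hT,
    card_quad hexp h12 h13 h23]

/-- **THE STABILISER OF THE MAJORITY TYPE IS THE JOINT KERNEL `N = ker χ₁ ∩ ker χ₂ ∩ ker χ₃`** (`⊇`: `T` is a
union of `N`-cosets; `⊆`: a stabilising element lies in the kernel of every survivor, tree g38-#1).  On the field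
side: `Maj` is induced from the octic CM subfield `K^N` and from no smaller field. [cite: Kubota1965, §2]
[cite: Kubota1965, §4 Lemma 2] -/
theorem forall_mul_mem_iff_iff_of_majority (hexp : ∀ g : G, g ^ 2 = 1) (hρ2 : ρ * ρ = 1)
    (hχ₁ : χ₁ (Additive.ofMul ρ) = -1) (hχ₂ : χ₂ (Additive.ofMul ρ) = -1) (hχ₃ : χ₃ (Additive.ofMul ρ) = -1)
    (h12 : χ₁ ≠ χ₂) (h13 : χ₁ ≠ χ₃) (h23 : χ₂ ≠ χ₃)
    (hT : ∀ g : G, g ∈ T ↔ (χ₁ (Additive.ofMul g) = 1 ∧ χ₂ (Additive.ofMul g) = 1) ∨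
      (χ₁ (Additive.ofMul g) = 1 ∧ χ₃ (Additive.ofMul g) = 1) ∨ (χ₂ (Additive.ofMul g) = 1 ∧ χ₃ (Additive.ofMul g) = 1))
    (g : G) :
    (∀ t : G, t * g ∈ T ↔ t ∈ T) ↔
      χ₁ (Additive.ofMul g) = 1 ∧ χ₂ (Additive.ofMul g) = 1 ∧ χ₃ (Additive.ofMul g) = 1 := by
  have hsurv := survivors_eq_of_majority hexp hρ2 hχ₁ hχ₂ hχ₃ h12 h13 h23 hT
  have hmem : ∀ χ : AddChar (Additive G) ℂ, χ ∈ ({χ₁, χ₂, χ₃, χ₁ + χ₂ + χ₃} : Finset (AddChar (Additive G) ℂ)) →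
      χ (Additive.ofMul ρ) = -1 ∧ ∑ s ∈ T, χ (Additive.ofMul s) ≠ 0 := fun χ hχ => by
    rw [← hsurv, Finset.mem_filter, Finset.mem_filter] at hχ
    exact ⟨hχ.1.2, hχ.2⟩
  constructor
  · intro hg
    have e : ∀ χ : AddChar (Additive G) ℂ, χ ∈ ({χ₁, χ₂, χ₃, χ₁ + χ₂ + χ₃} : Finset (AddChar (Additive G) ℂ)) →
        χ (Additive.ofMul g) = 1 := fun χ hχ =>
      AbelianStabilizer.survivor_apply_eq_one_of_forall_mul_mem_iff hg (hmem χ hχ).1 (hmem χ hχ).2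
    exact ⟨e χ₁ (by simp), e χ₂ (by simp), e χ₃ (by simp)⟩
  · rintro ⟨h1, h2, h3⟩
    exact mul_mem_iff_of_majority hT h1 h2 h3

/-- **`|Stab(Maj)| = |G|/8`**: `8·#{g : Tg = T} = |G|` — the equality case, for the majority types, of the tree's
`card_le_eight_mul_card_filter_forall_mul_mem_iff_of_typeRank_eq_five` (`rank 5 ⟹ |G| ≤ 8|Stab|`).
[cite: Kubota1965, §2] [cite: Kubota1965, §4 Lemma 2] -/
theorem eight_mul_card_stabilizer_of_majority (hexp : ∀ g : G, g ^ 2 = 1) (hρ2 : ρ * ρ = 1)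
    (hχ₁ : χ₁ (Additive.ofMul ρ) = -1) (hχ₂ : χ₂ (Additive.ofMul ρ) = -1) (hχ₃ : χ₃ (Additive.ofMul ρ) = -1)
    (h12 : χ₁ ≠ χ₂) (h13 : χ₁ ≠ χ₃) (h23 : χ₂ ≠ χ₃)
    (hT : ∀ g : G, g ∈ T ↔ (χ₁ (Additive.ofMul g) = 1 ∧ χ₂ (Additive.ofMul g) = 1) ∨
      (χ₁ (Additive.ofMul g) = 1 ∧ χ₃ (Additive.ofMul g) = 1) ∨ (χ₂ (Additive.ofMul g) = 1 ∧ χ₃ (Additive.ofMul g) = 1)) :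
    8 * (Finset.univ.filter fun g : G => ∀ t : G, t * g ∈ T ↔ t ∈ T).card = Fintype.card G := by
  rw [Finset.filter_congr fun g _ => forall_mul_mem_iff_iff_of_majority hexp hρ2 hχ₁ hχ₂ hχ₃ h12 h13 h23 hT g]
  exact eight_mul_card_filter_eq_eq_eq_of_odd hexp hχ₁ hχ₂ hχ₃ h12 h13 h23 (Or.inl rfl) (Or.inl rfl) (Or.inl rfl)

end RankFive

/-! ## §4 Existence: three distinct odd characters and a type of rank `5` in every order `≥ 8` -/

section Existence

omit [DecidableEq G] in
/-- **Three distinct odd characters exist** on a finite commutative group of exponent `2` of order `≥ 8` (half of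
the `|G| ≥ 8` characters are odd for `ρ ≠ 1`, tree `two_mul_ncard_oddCharacters_eq_card`).
[cite: Kubota1965, §4 Lemma 2 (proof)] -/
theorem exists_three_odd (hexp : ∀ g : G, g ^ 2 = 1) (hρ1 : ρ ≠ 1) (h8 : 8 ≤ Fintype.card G) :
    ∃ χ₁ χ₂ χ₃ : AddChar (Additive G) ℂ, χ₁ (Additive.ofMul ρ) = -1 ∧ χ₂ (Additive.ofMul ρ) = -1 ∧
      χ₃ (Additive.ofMul ρ) = -1 ∧ χ₁ ≠ χ₂ ∧ χ₁ ≠ χ₃ ∧ χ₂ ≠ χ₃ := by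
  have hρ2 : ρ * ρ = 1 := mul_self_eq_one_mj hexp ρ
  have h1 := Literature.AlgebraicGeometry.Pohlmann1968.two_mul_ncard_oddCharacters_eq_card (G := G) hρ1 hρ2
  have hset : {χ : AddChar (Additive G) ℂ | χ (Additive.ofMul ρ) = -1} =
      ↑(Finset.univ.filter fun χ : AddChar (Additive G) ℂ => χ (Additive.ofMul ρ) = -1) := by
    ext χ; simp
  rw [hset, Set.ncard_coe_finset] at h1
  have hlt : 2 < (Finset.univ.filter fun χ : AddChar (Additive G) ℂ => χ (Additive.ofMul ρ) = -1).card := by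
    omega
  obtain ⟨χ₁, χ₂, χ₃, h₁, h₂, h₃, h12, h13, h23⟩ := Finset.two_lt_card_iff.1 hlt
  exact ⟨χ₁, χ₂, χ₃, (Finset.mem_filter.1 h₁).2, (Finset.mem_filter.1 h₂).2, (Finset.mem_filter.1 h₃).2,
    h12, h13, h23⟩

omit [DecidableEq G] in
/-- **A CM TYPE OF KUBOTA RANK `5` EXISTS ON EVERY FINITE COMMUTATIVE GROUP OF EXPONENT `2` AND ORDER `≥ 8`**, w.r.t.
any `ρ ≠ 1`: the majority type of three distinct odd characters.  (Field side: every multiquadratic CM field of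
degree `≥ 8` has a CM type of rank `5` — the extreme low rank `> 2`, tree `typeRank_eq_two_or_five_le`.)
[cite: Kubota1965, §4 Lemma 2] [cite: Gordon1999HodgeAVSurvey, §9.4.1 (Proposition [B.60])] -/
theorem exists_isCMTypeWith_typeRank_eq_five (hexp : ∀ g : G, g ^ 2 = 1) (hρ1 : ρ ≠ 1)
    (h8 : 8 ≤ Fintype.card G) :
    ∃ T : Finset G, IsCMTypeWith ρ (T : Set G) ∧ typeRank G (T : Set G) = 5 := by
  classical
  have hρ2 : ρ * ρ = 1 := mul_self_eq_one_mj hexp ρ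
  obtain ⟨χ₁, χ₂, χ₃, hχ₁, hχ₂, hχ₃, h12, h13, h23⟩ := exists_three_odd hexp hρ1 h8
  refine ⟨Finset.univ.filter fun g : G => (χ₁ (Additive.ofMul g) = 1 ∧ χ₂ (Additive.ofMul g) = 1) ∨
      (χ₁ (Additive.ofMul g) = 1 ∧ χ₃ (Additive.ofMul g) = 1) ∨ (χ₂ (Additive.ofMul g) = 1 ∧ χ₃ (Additive.ofMul g) = 1),
    isCMTypeWith_of_majority hexp hρ2 hχ₁ hχ₂ hχ₃ (fun g => by simp),
    typeRank_eq_five_of_majority hexp hρ2 hχ₁ hχ₂ hχ₃ h12 h13 h23 (fun g => by simp)⟩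

end Existence

end ExponentTwo

end CyclicCMType

end Literature.NumberTheory.ComplexMultiplication
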